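import Literature.Probability.FitznerVanDerHofstad2017.F3BoundsCellReduction
import HarnessLib

/-!
# Kernel-decidable evaluation of the `f₃` cell numerals `boundHD75 (Tables.cell …) n l v a` at rational data

PACKET. b2b-lace packet, LEAN TYPING SEAT 1 gen 29 (unit `b2b-lace-lean1-g29`).  HOME/LEMMAS node F3-CELLNUM-Q (`lean1-g29:claim2`).

WHAT. The cell theorems of `F3BoundsCellReduction` / `F3BoundsCellReductionAlt` / `F3BoundsCellSplit(Alt)` (and their `d := 10`
wirings `SrwCellSupsD10`, `SrwCellImSupsD10`) end in ONE closing numeral per (cell, cone):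
`boundHD75 (Tables.cell IMc Tc Uc Kc) n l 0 a ≤ b`, where `boundHD75 = H1 + H2 + H3 + H4D75 + H5` is the typed bound map of
[NoBLE] §3.3.5 (3.71)–(3.87) (`F3Bounds.boundH1 … boundH5`, `F3BoundsD75.boundH4D75`) — a rational function of the ten `β`-arguments
`a : F3Bounds.Args` and of the cell table entries, with one `max |α̲_F − 1| |ᾱ_F − 1|`.  When the tables are casts of ℚ tables (as the
`d := 10` sup tables `CellSupD10.tX = ((TUSupD10.tS2 · ·  : ℚ) : ℝ)` etc. are) and the arguments are rational, that numeral is the cast of a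
rational number.  This module provides the ℚ MIRROR: `ArgsQ` (ten rationals) with `ArgsQ.toArgs`, the rational bound map
`boundH1Q … boundH5Q`, `m3Q`, `boundHD75Q` copied symbol for symbol from `F3Bounds`, the cast identities `cast_boundH…Q`
(`((boundHD75Q IMq Tq Uq Kq n l a : ℚ) : ℝ) = boundHD75 (Tables.cell ↑IMq ↑Tq ↑Uq ↑Kq) n l v a.toArgs`), the closing rule
`boundHD75_cell_le_of_ratLe` (a decided `boundHD75Q … ≤ b` gives the real closing numeral), and a decidable well-formedness check
`ArgsQ.wfCheck` with `ArgsQ.toArgs_WF`.  So a consumer at rational data closes `hnum` and `a.WF` by `decide +kernel`.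

WHAT THIS FILE IS NOT. Dimension-free arithmetic plumbing over the landed bound map; no table, tuple, argument or closing inequality of
any analysis is fixed here; nothing is instantiated.  What-if / input-certification lane: the record (CERT REV 14) and its frame are untouched.

References: [NoBLE] = Fitzner–van der Hofstad, PTRF 169 (2017) 1041–1119 (bib key `FitznerVanDerHofstad2016NoBLE`), §3.3.5 (3.71)–(3.87)
pp. 1076–1079 (the bound map `BoundH[1..5]` and the cell suprema of (3.87)); [FvdH17] = Fitzner–van der Hofstad, EJP 22 (2017) no. 43, §2.5
and the notebook `General.nb` In[2] (`BoundH`).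
-/

noncomputable section

namespace Literature.Probability.FitznerVanDerHofstad2017

namespace F3Bounds

namespace CellNumQ

/-! ## §1. Rational arguments -/

/-- The ten `β`-arguments of the bound map `BoundH[1..5]` of [NoBLE] (3.71)–(3.87) as RATIONALS (mirror of `F3Bounds.Args`):
`Γ₂′, c̄_Φ, α̲_F, ᾱ_F, β_{α,Φ}, β_{R,F}, β_{R,Φ}, β_{|ΔR,F|}, β_{ΔR,Φ}, K̲`.
[cite: FitznerVanDerHofstad2016NoBLE, §3.3.4 "Bounds on key quantities" pp. 1071–1074; §3.3.5 (3.71)–(3.87) pp. 1076–1079] -/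
structure ArgsQ where
  /-- `Γ₂′` -/
  Gamma2dash : ℚ
  /-- `c̄_Φ` -/
  cp : ℚ
  /-- `α̲_F` -/
  afmin : ℚ
  /-- `ᾱ_F` -/
  afmax : ℚ
  /-- `β_{α,Φ}` -/
  ap : ℚ
  /-- `β_{R,F}` -/
  bRf : ℚ
  /-- `β_{R,Φ}` -/
  bRp : ℚ
  /-- `β_{|ΔR,F|}` -/
  bRfDelta : ℚ
  /-- `β_{ΔR,Φ}` -/
  bRpDelta : ℚ
  /-- `K̲` -/
  Kunderline : ℚ

/-- The cast `ArgsQ → Args` (fieldwise `ℚ → ℝ`). [cite: FitznerVanDerHofstad2016NoBLE, §3.3.5 (3.71)–(3.87) pp. 1076–1079] -/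
def ArgsQ.toArgs (q : ArgsQ) : Args :=
  ⟨q.Gamma2dash, q.cp, q.afmin, q.afmax, q.ap, q.bRf, q.bRp, q.bRfDelta, q.bRpDelta, q.Kunderline⟩

/-- Decidable well-formedness check (mirror of `F3Bounds.Args.WF`: `α̲_F > 0`, the other listed arguments `≥ 0`).
[cite: FitznerVanDerHofstad2016NoBLE, §3.3.5 (3.71)–(3.87) pp. 1076–1079] -/
def ArgsQ.wfCheck (q : ArgsQ) : Bool :=
  decide (0 ≤ q.Gamma2dash) && decide (0 ≤ q.cp) && decide (0 < q.afmin) && decide (0 ≤ q.afmax) && decide (0 ≤ q.ap) &&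
    decide (0 ≤ q.bRp) && decide (0 ≤ q.bRfDelta) && decide (0 ≤ q.bRpDelta) && decide (0 ≤ q.Kunderline)

/-- A passed check gives `Args.WF` of the cast arguments. [cite: FitznerVanDerHofstad2016NoBLE, §3.3.5 (3.71)–(3.87) pp. 1076–1079] -/
theorem ArgsQ.toArgs_WF {q : ArgsQ} (h : q.wfCheck = true) : q.toArgs.WF := by
  simp only [ArgsQ.wfCheck, Bool.and_eq_true, decide_eq_true_eq] at h
  obtain ⟨⟨⟨⟨⟨⟨⟨⟨h1, h2⟩, h3⟩, h4⟩, h5⟩, h6⟩, h7⟩, h8⟩, h9⟩ := h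
  refine ⟨?_, ?_, ?_, ?_, ?_, ?_, ?_, ?_, ?_⟩ <;> dsimp only [ArgsQ.toArgs] <;> assumption_mod_cast

/-- Field-by-field identification of real arguments with the cast of rational ones: a consumer whose `a : Args` is a dictionary of
literals (e.g. an unfolded `NobleBetaF3.toArgs d B E Γ₂`) proves the ten scalar identities (`norm_num`) and rewrites `a = q.toArgs`.
[cite: FitznerVanDerHofstad2016NoBLE, §3.3.5 (3.71)–(3.87) pp. 1076–1079] -/
theorem ArgsQ.eq_toArgs {a : Args} {q : ArgsQ} (h₁ : a.Gamma2dash = q.Gamma2dash) (h₂ : a.cp = q.cp) (h₃ : a.afmin = q.afmin)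
    (h₄ : a.afmax = q.afmax) (h₅ : a.ap = q.ap) (h₆ : a.bRf = q.bRf) (h₇ : a.bRp = q.bRp) (h₈ : a.bRfDelta = q.bRfDelta)
    (h₉ : a.bRpDelta = q.bRpDelta) (h₁₀ : a.Kunderline = q.Kunderline) : a = q.toArgs := by
  cases a; dsimp only at h₁ h₂ h₃ h₄ h₅ h₆ h₇ h₈ h₉ h₁₀; subst h₁ h₂ h₃ h₄ h₅ h₆ h₇ h₈ h₉ h₁₀; rfl

/-! ## §2. The rational bound map on cell tables -/

section Map

variable (IMq : ℤ → ℕ → ℚ) (Tq Uq Kq : ℕ → ℕ → ℚ)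

/-- The CELL tables of rational cell constants, cast to `ℝ` (`Tables.cell ↑IMq ↑Tq ↑Uq ↑Kq`).
[cite: FitznerVanDerHofstad2016NoBLE, §3.3.5 (3.87) p. 1079 (cell suprema `sup_{x ∈ S}`)] -/
def cellQ {ν : Type*} : Tables ν :=
  Tables.cell (fun m l => ((IMq m l : ℚ) : ℝ)) (fun m l => ((Tq m l : ℚ) : ℝ)) (fun m l => ((Uq m l : ℚ) : ℝ))
    (fun m l => ((Kq m l : ℚ) : ℝ))

/-- ℚ mirror of `F3Bounds.boundH1` ((3.71): cases `n = 0, 1, 2`; sentinel `−1` for `n ≥ 3`) on cell tables.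
[cite: FitznerVanDerHofstad2016NoBLE, §3.3.5 (3.61)–(3.71) pp. 1074–1077; FitznerVanDerHofstad2017, notebook General.nb In[2]] -/
def boundH1Q (n l : ℕ) (a : ArgsQ) : ℚ :=
  match n with
  | 0 => a.cp * IMq 0 l + a.ap * IMq 0 (l+1) + a.ap / a.afmin * IMq (-1) l
  | 1 => a.cp ^ 2 / a.afmin * IMq 1 l + a.cp * a.ap / a.afmin * IMq 0 l
        + 2 * (a.ap * a.cp / a.afmin) * IMq 1 (l+1) + a.ap ^ 2 / a.afmin * IMq 0 (l+1)
        + a.ap ^ 2 / a.afmin * IMq 1 (l+2)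
        + (a.bRp + a.bRfDelta * a.Gamma2dash) / a.afmin ^ 2
            * (a.cp * Tq 3 l + a.ap * Tq 3 (l+1) + a.ap * Tq 2 l)
  | 2 => a.cp ^ 3 / a.afmin ^ 2 * IMq 2 l + a.cp ^ 2 * a.ap / a.afmin ^ 2 * IMq 1 l
        + 3 * (a.ap * a.cp ^ 2 / a.afmin ^ 2) * IMq 2 (l+1)
        + 2 * a.cp ^ 2 * a.ap / a.afmin ^ 2 * IMq 1 (l+1)
        + 3 * (a.ap ^ 2 * a.cp / a.afmin ^ 2) * IMq 2 (l+2)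
        + a.ap ^ 3 / a.afmin ^ 2 * IMq 1 (l+2) + a.ap ^ 3 / a.afmin ^ 2 * IMq 2 (l+3)
        + (a.bRp + a.bRfDelta * a.Gamma2dash) / a.afmin ^ 2 * (a.cp / a.afmin + a.Gamma2dash)
            * (a.cp * Tq 4 l + a.ap * Tq 4 (l+1) + a.ap * Tq 3 l)
        + a.ap * ((a.bRp + a.bRfDelta * a.Gamma2dash) / a.afmin ^ 3)
            * (a.cp * Tq 4 (l+1) + a.ap * Tq 4 (l+2) + a.ap * Tq 3 (l+1))
  | _ + 3 => -1

/-- ℚ mirror of `F3Bounds.boundH2` ((3.74)) on cell tables.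
[cite: FitznerVanDerHofstad2016NoBLE, §3.3.5 (3.74) p. 1077; FitznerVanDerHofstad2017, notebook General.nb In[2]] -/
def boundH2Q (n l : ℕ) (a : ArgsQ) : ℚ :=
  a.bRfDelta * a.Gamma2dash ^ n * a.Kunderline
      * ((a.cp * Tq (n+2) l + a.ap * Tq (n+2) (l+1)) * (1 / a.afmin + a.Kunderline)
          + a.ap / a.afmin * Tq (n+1) l)
    + a.afmax * a.bRpDelta * a.Kunderline ^ 2 * Tq (n+2) l

/-- ℚ mirror of `F3Bounds.m3` = `max |α̲_F − 1| |ᾱ_F − 1|`. [cite: FitznerVanDerHofstad2016NoBLE, §3.3.5 (3.77) p. 1077] -/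
def m3Q (a : ArgsQ) : ℚ := max |a.afmin - 1| |a.afmax - 1|

/-- ℚ mirror of `F3Bounds.boundH3` ((3.77)) on cell tables.
[cite: FitznerVanDerHofstad2016NoBLE, §3.3.5 (3.77) p. 1077; FitznerVanDerHofstad2017, notebook General.nb In[2]] -/
def boundH3Q (n l : ℕ) (a : ArgsQ) : ℚ :=
  2 * a.Kunderline ^ 2 * a.Gamma2dash ^ n * a.ap * (a.bRfDelta / a.afmin + m3Q a) * Uq (n+2) l
    + 2 * a.Kunderline ^ 2 * a.Gamma2dash ^ (n+1) * (a.afmax * m3Q a + a.bRfDelta) * Uq (n+3) l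

/-- ℚ mirror of `F3Bounds.boundH4D75` (Step 4 in the App.-C-consistent form, divergence D75) on cell tables.
[cite: FitznerVanDerHofstad2016NoBLE, §3.3.5 Step 4 (3.78) p. 1077, App.-C-consistent form; FitznerVanDerHofstad2017, notebook General.nb In[2] with the D75 patch] -/
def boundH4Q (n l : ℕ) (a : ArgsQ) : ℚ :=
  a.Kunderline * a.Gamma2dash ^ n * (a.bRpDelta * Kq (n+1) l + a.bRfDelta * a.Gamma2dash * Kq (n+2) l)

/-- ℚ mirror of `F3Bounds.boundH5` ((3.86)) on cell tables.
[cite: FitznerVanDerHofstad2016NoBLE, §3.3.5 (3.86) p. 1079; FitznerVanDerHofstad2017, notebook General.nb In[2]] -/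
def boundH5Q (n l : ℕ) (a : ArgsQ) : ℚ :=
  2 * a.Kunderline ^ 2 * a.Gamma2dash ^ (n+1) * (2 * a.afmax * a.bRfDelta + a.bRfDelta ^ 2) * Uq (n+3) l
    + 2 * a.Kunderline ^ 2 * a.Gamma2dash ^ n
        * (a.afmax * a.bRpDelta + (a.ap + a.bRpDelta) * a.bRfDelta) * Uq (n+2) l

/-- ℚ mirror of `F3Bounds.boundHD75 = H1 + H2 + H3 + H4D75 + H5` (the numerator of (3.87)) on cell tables.
[cite: FitznerVanDerHofstad2016NoBLE, §3.3.5 (3.87) p. 1079; FitznerVanDerHofstad2017, notebook General.nb In[2]] -/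
def boundHD75Q (n l : ℕ) (a : ArgsQ) : ℚ :=
  boundH1Q IMq Tq n l a + boundH2Q Tq n l a + boundH3Q Uq n l a + boundH4Q Kq n l a + boundH5Q Uq n l a

/-! ## §3. Cast identities and the closing rule -/

variable {ν : Type*} (v : ν)

/-- `boundH1Q` casts to `boundH1` of the cell tables at the cast arguments. [cite: FitznerVanDerHofstad2016NoBLE, §3.3.5 (3.71) p. 1077] -/
theorem cast_boundH1Q (n l : ℕ) (a : ArgsQ) :
    ((boundH1Q IMq Tq n l a : ℚ) : ℝ) = boundH1 (cellQ IMq Tq Uq Kq : Tables ν) n l v a.toArgs := by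
  rcases n with _ | _ | _ | n <;>
    simp only [boundH1Q, boundH1, cellQ, Tables.cell_IM, Tables.cell_T, ArgsQ.toArgs] <;> push_cast <;> ring_nf

/-- `boundH2Q` casts to `boundH2`. [cite: FitznerVanDerHofstad2016NoBLE, §3.3.5 (3.74) p. 1077] -/
theorem cast_boundH2Q (n l : ℕ) (a : ArgsQ) :
    ((boundH2Q Tq n l a : ℚ) : ℝ) = boundH2 (cellQ IMq Tq Uq Kq : Tables ν) n l v a.toArgs := by
  simp only [boundH2Q, boundH2, cellQ, Tables.cell_T, ArgsQ.toArgs]; push_cast; ring_nf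

/-- `m3Q` casts to `m3`. [cite: FitznerVanDerHofstad2016NoBLE, §3.3.5 (3.77) p. 1077] -/
theorem cast_m3Q (a : ArgsQ) : ((m3Q a : ℚ) : ℝ) = m3 a.toArgs := by
  simp only [m3Q, m3, ArgsQ.toArgs]; push_cast; ring_nf

/-- `boundH3Q` casts to `boundH3`. [cite: FitznerVanDerHofstad2016NoBLE, §3.3.5 (3.77) p. 1077] -/
theorem cast_boundH3Q (n l : ℕ) (a : ArgsQ) :
    ((boundH3Q Uq n l a : ℚ) : ℝ) = boundH3 (cellQ IMq Tq Uq Kq : Tables ν) n l v a.toArgs := by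
  rw [boundH3Q, boundH3, ← cast_m3Q]
  simp only [cellQ, Tables.cell_U, ArgsQ.toArgs]; push_cast; ring_nf

/-- `boundH4Q` casts to `boundH4D75`. [cite: FitznerVanDerHofstad2016NoBLE, §3.3.5 Step 4 (3.78) p. 1077, App.-C-consistent form] -/
theorem cast_boundH4Q (n l : ℕ) (a : ArgsQ) :
    ((boundH4Q Kq n l a : ℚ) : ℝ) = boundH4D75 (cellQ IMq Tq Uq Kq : Tables ν) n l v a.toArgs := by
  simp only [boundH4Q, boundH4D75, cellQ, Tables.cell_K, ArgsQ.toArgs]; push_cast; ring_nf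

/-- `boundH5Q` casts to `boundH5`. [cite: FitznerVanDerHofstad2016NoBLE, §3.3.5 (3.86) p. 1079] -/
theorem cast_boundH5Q (n l : ℕ) (a : ArgsQ) :
    ((boundH5Q Uq n l a : ℚ) : ℝ) = boundH5 (cellQ IMq Tq Uq Kq : Tables ν) n l v a.toArgs := by
  simp only [boundH5Q, boundH5, cellQ, Tables.cell_U, ArgsQ.toArgs]; push_cast; ring_nf

/-- **`boundHD75Q` casts to the cell numeral `boundHD75 (Tables.cell ↑IMq ↑Tq ↑Uq ↑Kq) n l v a.toArgs`** (any node `v`: the cell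
tables are node-independent). [cite: FitznerVanDerHofstad2016NoBLE, §3.3.5 (3.87) p. 1079] -/
theorem cast_boundHD75Q (n l : ℕ) (a : ArgsQ) :
    ((boundHD75Q IMq Tq Uq Kq n l a : ℚ) : ℝ) = boundHD75 (cellQ IMq Tq Uq Kq : Tables ν) n l v a.toArgs := by
  simp only [boundHD75Q, boundHD75, Rat.cast_add, cast_boundH1Q IMq Tq Uq Kq v, cast_boundH2Q IMq Tq Uq Kq v,
    cast_boundH3Q IMq Tq Uq Kq v, cast_boundH4Q IMq Tq Uq Kq v, cast_boundH5Q IMq Tq Uq Kq v]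

/-- **The closing rule**: a (kernel-)decided `boundHD75Q IMq Tq Uq Kq n l a ≤ b` gives the real closing numeral
`boundHD75 (Tables.cell ↑IMq ↑Tq ↑Uq ↑Kq) n l v a.toArgs ≤ b` of the cell theorems (`hnum`).
[cite: FitznerVanDerHofstad2016NoBLE, §3.3.5 (3.87) p. 1079] -/
theorem boundHD75_cell_le_of_ratLe {n l : ℕ} {a : ArgsQ} {b : ℚ} (h : boundHD75Q IMq Tq Uq Kq n l a ≤ b) :
    boundHD75 (Tables.cell (fun m l => ((IMq m l : ℚ) : ℝ)) (fun m l => ((Tq m l : ℚ) : ℝ)) (fun m l => ((Uq m l : ℚ) : ℝ))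
      (fun m l => ((Kq m l : ℚ) : ℝ)) : Tables ν) n l v a.toArgs ≤ ((b : ℚ) : ℝ) := by
  rw [← cellQ, ← cast_boundHD75Q]; exact_mod_cast h

/-- Strict version of the closing rule. [cite: FitznerVanDerHofstad2016NoBLE, §3.3.5 (3.87) p. 1079] -/
theorem boundHD75_cell_lt_of_ratLt {n l : ℕ} {a : ArgsQ} {b : ℚ} (h : boundHD75Q IMq Tq Uq Kq n l a < b) :
    boundHD75 (Tables.cell (fun m l => ((IMq m l : ℚ) : ℝ)) (fun m l => ((Tq m l : ℚ) : ℝ)) (fun m l => ((Uq m l : ℚ) : ℝ))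
      (fun m l => ((Kq m l : ℚ) : ℝ)) : Tables ν) n l v a.toArgs < ((b : ℚ) : ℝ) := by
  rw [← cellQ, ← cast_boundHD75Q]; exact_mod_cast h

end Map

end CellNumQ

end F3Bounds

end Literature.Probability.FitznerVanDerHofstad2017
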